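import Mathlib
import HarnessLib
import Summits.Ventures.LatticeQCDFlow.Exactness.SplittingIntegrator

/-!
# Multi-step leapfrog with a Lipschitz force: the `n`-step position map is a global perturbation of `p ↦ θ₀ + nδ·p`

HONEST FRAMING: exact (Metropolis-corrected) sampling algorithms for lattice gauge theory;
figures of merit are autocorrelation/cost numbers at stated couplings and volumes; no
continuum-physics claim.

Venture `LatticeQCDFlow` (cell pub-lqcd), topic `Exactness`, FANOUT row 9 (eng-latcore, the
engine `latflow.core.hmc.HMC(..., 'leapfrog').trajectory(τ, nstep)` and
`u1_2d.U1Field2D.hmc_trajectory(β, τ, nstep)` with `nstep ≥ 2`).  NEW WORK of the cell over Mathlib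
and the tree's `SplittingIntegrator.lean` (`kick`, `drift`, `addDrift`); nothing here is cited as a
fact.  Printed counterparts, named only: Duane–Kennedy–Pendleton–Roweth 1987 (leapfrog HMC),
Mackenzie 1989 (fixed trajectory lengths can be non-ergodic), Bou-Rabee–Sanz-Serna 2017/2018 and
Durmus–Moulines–Saksman 2020 (irreducibility of HMC under step-size / trajectory-length conditions).

The tree's ergodicity theorems for HMC (`U1LeapfrogHMCErgodic`, `SU2LeapfrogHMCErgodic`,
`SUNLeapfrogHMCErgodic`, `SphereFamilyLeapfrogHMCErgodic`, …) all assume `nstep = 1`: with ONE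
drift the proposed configuration is one exponential of a Gaussian momentum.  With `nstep ≥ 2` the
force is read at intermediate configurations and the proposal is a genuine composition.  This file
is the ANALYTIC CORE of the multi-step case on a flat phase space `E × E` (`E` any real normed
space; the torus / `U(1)` lattice is reached through the angle lift in `U1MultiStepLeapfrogHMC.lean`):

* `lfStep G δ` — one P-first leapfrog step `K(G) D(δ) K(G)` as a function, `= ⇑(kick G * drift
  (addDrift (δ • id)) * kick G)` (`coe_kick_drift_kick`); `lfTraj G δ θ₀ p k = (θ_k, m_k)` — the
  trajectory in half-step form (`m_k` = the momentum that drives drift `k+1`, i.e. `p_{k+½}` up to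
  the last half kick), `lfStep_iterate` — `(lfStep G δ)^[k] (θ₀, p) = (θ_k, m_k − G θ_k)`;
* one trajectory, force bounded by `b`: `‖m_k − p‖ ≤ (2k+1) b`, `‖θ_k − θ₀ − (kδ)•p‖ ≤ δ b k²`,
  `‖((lfStep G δ)^[k] (θ₀,p)).2‖ ≤ ‖p‖ + 2(k+1) b` (momenta stay in a box: the energy window);
* **`lfTraj_two_point`** / **`lfTraj_pos_approx`** — THE ESTIMATE: if `G` is `K`-Lipschitz, `δ ≥ 0`
  and `4 K δ n² ≤ 3`, then for every pair of initial momenta `p, p'` (same `θ₀`)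
  `‖θ_n(p) − θ_n(p') − (nδ)•(p − p')‖ ≤ (nδ/3)·‖p − p'‖` — the `n`-step position map is, GLOBALLY
  on momentum space, within a `⅓`-relative Lipschitz perturbation of the dilation by the trajectory
  length `τ = nδ` (discrete Grönwall: `‖Δm_k − Δp‖ ≤ (4/3)Kδ k(k+1)‖Δp‖`,
  `‖Δθ_k − kδΔp‖ ≤ (4/9)Kδ²(k³ − k)‖Δp‖` by a joint induction);
  `lfTraj_pos_lipschitz` / `lfTraj_pos_expand` — hence `(2τ/3)‖p − p'‖ ≤ ‖θ_n(p) − θ_n(p')‖ ≤ (4τ/3)‖p − p'‖`.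

In the engine's variables (`g = −½·dt·∂S` the half kick, drift by `dt`): `K = Lip(g)`, `δ = dt`,
and the hypothesis reads `4·Lip(g)·dt·nstep² ≤ 3`, i.e. `Lip(∂S)·τ² ≤ 3/2` with `τ = nstep·dt` —
a SHORT-TRAJECTORY condition.  NOT CLAIMED: anything for `Lip(∂S)·τ² > 3/2` (fixed-length
trajectories can then be non-ergodic — Mackenzie 1989 — and nothing is asserted); OMF words (the same
induction with other coefficients, not written); curved configuration spaces other than through a
flat lift (tori: `U1MultiStepLeapfrogHMC.lean`; `SU(N)`, spheres: not here); floating point.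
-/

noncomputable section

namespace Summit.Ventures.LatticeQCDFlow.Exactness

open Set NNReal

variable {E : Type*} [NormedAddCommGroup E] [NormedSpace ℝ E]

/-! ## §1 The flat leapfrog step and the half-step trajectory -/

section Defs

/-- **One P-first leapfrog step** `K(G) D(δ) K(G)` on the flat phase space `E × E`, as a function:
kick `p ← p + G θ`, drift `θ ← θ + δ p`, kick `p ← p + G θ`. -/
def lfStep (G : E → E) (δ : ℝ) (z : E × E) : E × E :=
  (z.1 + δ • (z.2 + G z.1), z.2 + G z.1 + G (z.1 + δ • (z.2 + G z.1)))

/-- **The trajectory in half-step form** from `(θ₀, p)`: `lfTraj G δ θ₀ p k = (θ_k, m_k)` with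
`m_0 = p + G θ₀`, `θ_{k+1} = θ_k + δ m_k`, `m_{k+1} = m_k + 2 G θ_{k+1}` (`m_k` drives drift `k+1`). -/
def lfTraj (G : E → E) (δ : ℝ) (θ₀ p : E) : ℕ → E × E
  | 0 => (θ₀, p + G θ₀)
  | k + 1 => ((lfTraj G δ θ₀ p k).1 + δ • (lfTraj G δ θ₀ p k).2,
      (lfTraj G δ θ₀ p k).2 + (2 : ℝ) • G ((lfTraj G δ θ₀ p k).1 + δ • (lfTraj G δ θ₀ p k).2))

variable (G : E → E) (δ : ℝ) (θ₀ p : E)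

/-- The step at `0`. -/
@[simp] theorem lfTraj_zero : lfTraj G δ θ₀ p 0 = (θ₀, p + G θ₀) := rfl

/-- The recursion, first component. -/
theorem lfTraj_succ_fst (k : ℕ) :
    (lfTraj G δ θ₀ p (k + 1)).1 = (lfTraj G δ θ₀ p k).1 + δ • (lfTraj G δ θ₀ p k).2 := rfl

/-- The recursion, second component. -/
theorem lfTraj_succ_snd (k : ℕ) :
    (lfTraj G δ θ₀ p (k + 1)).2 =
      (lfTraj G δ θ₀ p k).2 + (2 : ℝ) • G (lfTraj G δ θ₀ p (k + 1)).1 := rfl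

/-- **The tree's permutation word is this step**: `⇑(kick G * drift (addDrift (δ • id)) * kick G) =
lfStep G δ` (`SplittingIntegrator.kick/drift/addDrift`). -/
theorem coe_kick_drift_kick :
    ⇑(kick G * drift (addDrift (DistribSMul.toAddMonoidHom E δ)) * kick G) = lfStep G δ := by
  funext z
  rfl

/-- **`k` leapfrog steps in half-step form**: `(lfStep G δ)^[k] (θ₀, p) = (θ_k, m_k − G θ_k)`. -/
theorem lfStep_iterate (k : ℕ) :
    (lfStep G δ)^[k] (θ₀, p) = ((lfTraj G δ θ₀ p k).1, (lfTraj G δ θ₀ p k).2 - G (lfTraj G δ θ₀ p k).1) := by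
  induction k with
  | zero => simp
  | succ k ih =>
    rw [Function.iterate_succ_apply', ih, lfTraj_succ_snd, lfTraj_succ_fst]
    simp only [lfStep, sub_add_cancel, two_smul, Prod.mk.injEq, true_and]
    abel

/-- The position after `k` steps of the word is `θ_k`. -/
theorem lfStep_iterate_fst (k : ℕ) :
    ((lfStep G δ)^[k] (θ₀, p)).1 = (lfTraj G δ θ₀ p k).1 := by
  rw [lfStep_iterate]

/-- The momentum after `k` steps of the word is `m_k − G θ_k`. -/
theorem lfStep_iterate_snd (k : ℕ) :
    ((lfStep G δ)^[k] (θ₀, p)).2 = (lfTraj G δ θ₀ p k).2 - G (lfTraj G δ θ₀ p k).1 := by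
  rw [lfStep_iterate]

end Defs

/-! ## §2 One trajectory with a bounded force: momenta stay in a box, positions near `θ₀ + kδ·p` -/

section OneTrajectory

variable {G : E → E} {δ b : ℝ} {θ₀ p : E}

/-- **`‖m_k − p‖ ≤ (2k+1) b`** for a force bounded by `b`. -/
theorem lfTraj_snd_sub_le (hb : ∀ x, ‖G x‖ ≤ b) (k : ℕ) :
    ‖(lfTraj G δ θ₀ p k).2 - p‖ ≤ (2 * k + 1) * b := by
  induction k with
  | zero => simpa using hb θ₀
  | succ k ih =>
    rw [lfTraj_succ_snd]
    have h2 : ‖(2 : ℝ) • G (lfTraj G δ θ₀ p (k + 1)).1‖ ≤ 2 * b := by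
      rw [norm_smul, Real.norm_two]
      exact mul_le_mul_of_nonneg_left (hb _) zero_le_two
    calc ‖(lfTraj G δ θ₀ p k).2 + (2 : ℝ) • G (lfTraj G δ θ₀ p (k + 1)).1 - p‖
        = ‖((lfTraj G δ θ₀ p k).2 - p) + (2 : ℝ) • G (lfTraj G δ θ₀ p (k + 1)).1‖ := by abel_nf
      _ ≤ ‖(lfTraj G δ θ₀ p k).2 - p‖ + ‖(2 : ℝ) • G (lfTraj G δ θ₀ p (k + 1)).1‖ := norm_add_le _ _
      _ ≤ (2 * k + 1) * b + 2 * b := add_le_add ih h2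
      _ = (2 * (↑(k + 1) : ℝ) + 1) * b := by push_cast; ring

/-- **`‖θ_k − θ₀ − (kδ)•p‖ ≤ δ b k²`** for a force bounded by `b` and `δ ≥ 0`. -/
theorem lfTraj_fst_sub_le (hb : ∀ x, ‖G x‖ ≤ b) (hδ : 0 ≤ δ) (k : ℕ) :
    ‖(lfTraj G δ θ₀ p k).1 - θ₀ - ((k : ℝ) * δ) • p‖ ≤ δ * b * (k : ℝ) ^ 2 := by
  induction k with
  | zero => simp
  | succ k ih =>
    rw [lfTraj_succ_fst]
    have hsplit : (lfTraj G δ θ₀ p k).1 + δ • (lfTraj G δ θ₀ p k).2 - θ₀ - ((↑(k + 1) : ℝ) * δ) • p =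
        ((lfTraj G δ θ₀ p k).1 - θ₀ - ((k : ℝ) * δ) • p) + δ • ((lfTraj G δ θ₀ p k).2 - p) := by
      push_cast
      module
    rw [hsplit]
    calc ‖((lfTraj G δ θ₀ p k).1 - θ₀ - ((k : ℝ) * δ) • p) + δ • ((lfTraj G δ θ₀ p k).2 - p)‖
        ≤ ‖(lfTraj G δ θ₀ p k).1 - θ₀ - ((k : ℝ) * δ) • p‖ + ‖δ • ((lfTraj G δ θ₀ p k).2 - p)‖ :=
          norm_add_le _ _
      _ ≤ δ * b * (k : ℝ) ^ 2 + δ * ((2 * k + 1) * b) := by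
          rw [norm_smul, Real.norm_of_nonneg hδ]
          exact add_le_add ih (mul_le_mul_of_nonneg_left (lfTraj_snd_sub_le hb k) hδ)
      _ = δ * b * ((↑(k + 1) : ℝ)) ^ 2 := by push_cast; ring

/-- **The momenta stay in a box**: `‖((lfStep G δ)^[k] (θ₀, p)).2‖ ≤ ‖p‖ + 2(k+1) b` (the final
momentum of `k` steps, before the flip; `b` bounds the half-kick). -/
theorem norm_lfStep_iterate_snd_le (hb : ∀ x, ‖G x‖ ≤ b) (k : ℕ) :
    ‖((lfStep G δ)^[k] (θ₀, p)).2‖ ≤ ‖p‖ + 2 * ((k : ℝ) + 1) * b := by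
  rw [lfStep_iterate_snd]
  calc ‖(lfTraj G δ θ₀ p k).2 - G (lfTraj G δ θ₀ p k).1‖
      = ‖p + ((lfTraj G δ θ₀ p k).2 - p) - G (lfTraj G δ θ₀ p k).1‖ := by abel_nf
    _ ≤ ‖p‖ + ‖(lfTraj G δ θ₀ p k).2 - p‖ + ‖G (lfTraj G δ θ₀ p k).1‖ :=
        (norm_sub_le _ _).trans (add_le_add (norm_add_le _ _) le_rfl)
    _ ≤ ‖p‖ + (2 * k + 1) * b + b := add_le_add (add_le_add le_rfl (lfTraj_snd_sub_le hb k)) (hb _)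
    _ = ‖p‖ + 2 * ((k : ℝ) + 1) * b := by ring

/-- **The end point of the `p = 0`-shifted picture**: `‖θ_k − (θ₀ + (kδ)•p)‖ ≤ δ b k²`, restated with
the dilation on the other side (the centre of the ball the position law will be shown to cover). -/
theorem dist_lfTraj_fst_le (hb : ∀ x, ‖G x‖ ≤ b) (hδ : 0 ≤ δ) (k : ℕ) :
    dist ((lfTraj G δ θ₀ p k).1) (θ₀ + ((k : ℝ) * δ) • p) ≤ δ * b * (k : ℝ) ^ 2 := by
  rw [dist_eq_norm, ← sub_sub]
  exact lfTraj_fst_sub_le hb hδ k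

end OneTrajectory

/-! ## §3 Two trajectories with a Lipschitz force: the discrete Grönwall estimate -/

section TwoTrajectories

variable {G : E → E} {K : ℝ≥0} {δ : ℝ} {θ₀ : E} {n : ℕ}

/-- Arithmetic: under `4 K δ n² ≤ 3`, `K δ ≥ 0` and `u ≤ n`, `(4/9) K δ (u² − 1) ≤ 1/3`. -/
theorem short_traj_aux (hKδ : 0 ≤ (K : ℝ) * δ) (hn : 4 * (K : ℝ) * δ * (n : ℝ) ^ 2 ≤ 3) {u : ℕ}
    (hu : u ≤ n) : 4 / 9 * (K : ℝ) * δ * ((u : ℝ) ^ 2 - 1) ≤ 1 / 3 := by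
  have hu' : (u : ℝ) ^ 2 - 1 ≤ (n : ℝ) ^ 2 := by
    have : (u : ℝ) ^ 2 ≤ (n : ℝ) ^ 2 := pow_le_pow_left₀ (Nat.cast_nonneg _) (Nat.cast_le.2 hu) 2
    linarith
  nlinarith [mul_le_mul_of_nonneg_left hu' hKδ]

/-- **THE JOINT INDUCTION (discrete Grönwall).**  `G` `K`-Lipschitz, `δ ≥ 0`, `4 K δ n² ≤ 3`; two
trajectories from `(θ₀, p)` and `(θ₀, p')`.  For every `k ≤ n`:
`‖m_k − m'_k − (p − p')‖ ≤ (4/3) K δ k(k+1) ‖p − p'‖` and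
`‖θ_k − θ'_k − (kδ)•(p − p')‖ ≤ (4/9) K δ² (k³ − k) ‖p − p'‖`. -/
theorem lfTraj_two_point (hG : LipschitzWith K G) (hδ : 0 ≤ δ)
    (hn : 4 * (K : ℝ) * δ * (n : ℝ) ^ 2 ≤ 3) (p p' : E) :
    ∀ k ≤ n,
      ‖(lfTraj G δ θ₀ p k).2 - (lfTraj G δ θ₀ p' k).2 - (p - p')‖ ≤
          4 / 3 * K * δ * ((k : ℝ) * (k + 1)) * ‖p - p'‖ ∧
        ‖(lfTraj G δ θ₀ p k).1 - (lfTraj G δ θ₀ p' k).1 - ((k : ℝ) * δ) • (p - p')‖ ≤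
          4 / 9 * K * δ ^ 2 * ((k : ℝ) ^ 3 - k) * ‖p - p'‖ := by
  have hK0 : 0 ≤ (K : ℝ) := K.coe_nonneg
  have hKδ : 0 ≤ (K : ℝ) * δ := mul_nonneg hK0 hδ
  set N : ℝ := ‖p - p'‖ with hN
  have hN0 : 0 ≤ N := norm_nonneg _
  intro k
  induction k with
  | zero =>
    intro _
    constructor
    · have h0 : (lfTraj G δ θ₀ p 0).2 - (lfTraj G δ θ₀ p' 0).2 - (p - p') = 0 := by
        simp only [lfTraj_zero]; abel
      rw [h0, norm_zero]
      simp
    · simp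
  | succ k ih =>
    intro hk
    have hkn : k ≤ n := Nat.le_of_succ_le hk
    obtain ⟨iha, ihb⟩ := ih hkn
    -- abbreviations
    set θk := (lfTraj G δ θ₀ p k).1 with hθk
    set θk' := (lfTraj G δ θ₀ p' k).1 with hθk'
    set mk := (lfTraj G δ θ₀ p k).2 with hmk
    set mk' := (lfTraj G δ θ₀ p' k).2 with hmk'
    have hθs : (lfTraj G δ θ₀ p (k + 1)).1 = θk + δ • mk := lfTraj_succ_fst G δ θ₀ p k
    have hθs' : (lfTraj G δ θ₀ p' (k + 1)).1 = θk' + δ • mk' := lfTraj_succ_fst G δ θ₀ p' k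
    -- (b_{k+1})
    have hb : ‖(lfTraj G δ θ₀ p (k + 1)).1 - (lfTraj G δ θ₀ p' (k + 1)).1 -
        (((↑(k + 1) : ℝ)) * δ) • (p - p')‖ ≤
        4 / 9 * K * δ ^ 2 * (((↑(k + 1) : ℝ)) ^ 3 - (↑(k + 1) : ℝ)) * N := by
      have hsplit : (lfTraj G δ θ₀ p (k + 1)).1 - (lfTraj G δ θ₀ p' (k + 1)).1 -
          (((↑(k + 1) : ℝ)) * δ) • (p - p') =
          (θk - θk' - ((k : ℝ) * δ) • (p - p')) + δ • (mk - mk' - (p - p')) := by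
        rw [hθs, hθs']
        push_cast
        module
      rw [hsplit]
      calc ‖(θk - θk' - ((k : ℝ) * δ) • (p - p')) + δ • (mk - mk' - (p - p'))‖
          ≤ ‖θk - θk' - ((k : ℝ) * δ) • (p - p')‖ + ‖δ • (mk - mk' - (p - p'))‖ := norm_add_le _ _
        _ ≤ 4 / 9 * K * δ ^ 2 * ((k : ℝ) ^ 3 - k) * N + δ * (4 / 3 * K * δ * ((k : ℝ) * (k + 1)) * N) := by
            rw [norm_smul, Real.norm_of_nonneg hδ]
            exact add_le_add ihb (mul_le_mul_of_nonneg_left iha hδ)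
        _ = 4 / 9 * K * δ ^ 2 * (((↑(k + 1) : ℝ)) ^ 3 - (↑(k + 1) : ℝ)) * N := by push_cast; ring
    refine ⟨?_, hb⟩
    -- (a_{k+1})
    have hms : (lfTraj G δ θ₀ p (k + 1)).2 = mk + (2 : ℝ) • G (lfTraj G δ θ₀ p (k + 1)).1 :=
      lfTraj_succ_snd G δ θ₀ p k
    have hms' : (lfTraj G δ θ₀ p' (k + 1)).2 = mk' + (2 : ℝ) • G (lfTraj G δ θ₀ p' (k + 1)).1 :=
      lfTraj_succ_snd G δ θ₀ p' k
    set u : ℝ := (↑(k + 1) : ℝ) with hu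
    have hu1 : (1 : ℝ) ≤ u := by rw [hu]; exact_mod_cast Nat.succ_le_succ (Nat.zero_le k)
    have hu0 : 0 ≤ u := zero_le_one.trans hu1
    -- the positions differ by at most (u δ + (4/9) K δ² (u³ − u)) N
    have hpos : ‖(lfTraj G δ θ₀ p (k + 1)).1 - (lfTraj G δ θ₀ p' (k + 1)).1‖ ≤
        (u * δ + 4 / 9 * K * δ ^ 2 * (u ^ 3 - u)) * N := by
      calc ‖(lfTraj G δ θ₀ p (k + 1)).1 - (lfTraj G δ θ₀ p' (k + 1)).1‖
          = ‖((lfTraj G δ θ₀ p (k + 1)).1 - (lfTraj G δ θ₀ p' (k + 1)).1 - (u * δ) • (p - p')) +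
              (u * δ) • (p - p')‖ := by rw [sub_add_cancel]
        _ ≤ ‖(lfTraj G δ θ₀ p (k + 1)).1 - (lfTraj G δ θ₀ p' (k + 1)).1 - (u * δ) • (p - p')‖ +
              ‖(u * δ) • (p - p')‖ := norm_add_le _ _
        _ ≤ 4 / 9 * K * δ ^ 2 * (u ^ 3 - u) * N + u * δ * N := by
            rw [norm_smul, Real.norm_of_nonneg (mul_nonneg hu0 hδ)]
            exact add_le_add hb le_rfl
        _ = (u * δ + 4 / 9 * K * δ ^ 2 * (u ^ 3 - u)) * N := by ring
    have hG2 : ‖(2 : ℝ) • G (lfTraj G δ θ₀ p (k + 1)).1 - (2 : ℝ) • G (lfTraj G δ θ₀ p' (k + 1)).1‖ ≤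
        2 * K * ((u * δ + 4 / 9 * K * δ ^ 2 * (u ^ 3 - u)) * N) := by
      rw [← smul_sub, norm_smul, Real.norm_two, mul_assoc]
      exact mul_le_mul_of_nonneg_left ((hG.norm_sub_le _ _).trans
        (mul_le_mul_of_nonneg_left hpos hK0)) zero_le_two
    have hsplit : (lfTraj G δ θ₀ p (k + 1)).2 - (lfTraj G δ θ₀ p' (k + 1)).2 - (p - p') =
        (mk - mk' - (p - p')) +
          ((2 : ℝ) • G (lfTraj G δ θ₀ p (k + 1)).1 - (2 : ℝ) • G (lfTraj G δ θ₀ p' (k + 1)).1) := by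
      rw [hms, hms']
      abel
    rw [hsplit]
    have haux : 4 / 9 * (K : ℝ) * δ * (u ^ 2 - 1) ≤ 1 / 3 := short_traj_aux hKδ hn hk
    calc ‖(mk - mk' - (p - p')) +
          ((2 : ℝ) • G (lfTraj G δ θ₀ p (k + 1)).1 - (2 : ℝ) • G (lfTraj G δ θ₀ p' (k + 1)).1)‖
        ≤ ‖mk - mk' - (p - p')‖ +
          ‖(2 : ℝ) • G (lfTraj G δ θ₀ p (k + 1)).1 - (2 : ℝ) • G (lfTraj G δ θ₀ p' (k + 1)).1‖ :=
          norm_add_le _ _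
      _ ≤ 4 / 3 * K * δ * ((k : ℝ) * (k + 1)) * N + 2 * K * ((u * δ + 4 / 9 * K * δ ^ 2 * (u ^ 3 - u)) * N) :=
          add_le_add iha hG2
      _ = 4 / 3 * K * δ * ((u - 1) * u) * N +
            2 * (K * δ * u * N) * (1 + 4 / 9 * K * δ * (u ^ 2 - 1)) := by
          rw [hu]; push_cast; ring
      _ ≤ 4 / 3 * K * δ * ((u - 1) * u) * N + 2 * (K * δ * u * N) * (4 / 3) := by
          have h0 : 0 ≤ K * δ * u * N := mul_nonneg (mul_nonneg hKδ hu0) hN0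
          nlinarith [mul_le_mul_of_nonneg_left haux h0]
      _ = 4 / 3 * K * δ * (u * (u + 1)) * N := by ring

/-- **THE `n`-STEP POSITION MAP IS A `⅓`-RELATIVE PERTURBATION OF THE DILATION BY `τ = nδ`,
GLOBALLY**: `G` `K`-Lipschitz, `δ ≥ 0`, `4 K δ n² ≤ 3` ⇒ for all `p, p'`,
`‖θ_n(p) − θ_n(p') − (nδ)•(p − p')‖ ≤ (nδ/3)‖p − p'‖`. -/
theorem lfTraj_pos_approx (hG : LipschitzWith K G) (hδ : 0 ≤ δ)
    (hn : 4 * (K : ℝ) * δ * (n : ℝ) ^ 2 ≤ 3) (p p' : E) :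
    ‖(lfTraj G δ θ₀ p n).1 - (lfTraj G δ θ₀ p' n).1 - ((n : ℝ) * δ) • (p - p')‖ ≤
      (n : ℝ) * δ / 3 * ‖p - p'‖ := by
  have hK0 : 0 ≤ (K : ℝ) := K.coe_nonneg
  have hKδ : 0 ≤ (K : ℝ) * δ := mul_nonneg hK0 hδ
  have hN0 : 0 ≤ ‖p - p'‖ := norm_nonneg _
  have hn0 : 0 ≤ (n : ℝ) := n.cast_nonneg
  refine ((lfTraj_two_point hG hδ hn p p' n le_rfl).2).trans ?_
  have h1 : (n : ℝ) ^ 3 - n ≤ (n : ℝ) ^ 3 := by linarith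
  have h2 : 4 / 9 * (K : ℝ) * δ * (n : ℝ) ^ 2 ≤ 1 / 3 := by nlinarith
  calc 4 / 9 * K * δ ^ 2 * ((n : ℝ) ^ 3 - n) * ‖p - p'‖
      ≤ 4 / 9 * K * δ ^ 2 * (n : ℝ) ^ 3 * ‖p - p'‖ := by
        have : 0 ≤ 4 / 9 * (K : ℝ) * δ ^ 2 := by positivity
        nlinarith [mul_le_mul_of_nonneg_left h1 this]
    _ = ((n : ℝ) * δ) * (4 / 9 * K * δ * (n : ℝ) ^ 2) * ‖p - p'‖ := by ring
    _ ≤ ((n : ℝ) * δ) * (1 / 3) * ‖p - p'‖ := by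
        have : 0 ≤ (n : ℝ) * δ := mul_nonneg hn0 hδ
        nlinarith [mul_le_mul_of_nonneg_left h2 this]
    _ = (n : ℝ) * δ / 3 * ‖p - p'‖ := by ring

/-- **Upper Lipschitz bound**: `‖θ_n(p) − θ_n(p')‖ ≤ (4nδ/3)‖p − p'‖`. -/
theorem lfTraj_pos_lipschitz (hG : LipschitzWith K G) (hδ : 0 ≤ δ)
    (hn : 4 * (K : ℝ) * δ * (n : ℝ) ^ 2 ≤ 3) (p p' : E) :
    ‖(lfTraj G δ θ₀ p n).1 - (lfTraj G δ θ₀ p' n).1‖ ≤ 4 * ((n : ℝ) * δ) / 3 * ‖p - p'‖ := by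
  have h := lfTraj_pos_approx (θ₀ := θ₀) hG hδ hn p p'
  have hτ : 0 ≤ (n : ℝ) * δ := mul_nonneg n.cast_nonneg hδ
  calc ‖(lfTraj G δ θ₀ p n).1 - (lfTraj G δ θ₀ p' n).1‖
      = ‖((lfTraj G δ θ₀ p n).1 - (lfTraj G δ θ₀ p' n).1 - ((n : ℝ) * δ) • (p - p')) +
          ((n : ℝ) * δ) • (p - p')‖ := by rw [sub_add_cancel]
    _ ≤ ‖(lfTraj G δ θ₀ p n).1 - (lfTraj G δ θ₀ p' n).1 - ((n : ℝ) * δ) • (p - p')‖ +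
          ‖((n : ℝ) * δ) • (p - p')‖ := norm_add_le _ _
    _ ≤ (n : ℝ) * δ / 3 * ‖p - p'‖ + (n : ℝ) * δ * ‖p - p'‖ := by
        rw [norm_smul, Real.norm_of_nonneg hτ]
        exact add_le_add h le_rfl
    _ = 4 * ((n : ℝ) * δ) / 3 * ‖p - p'‖ := by ring

/-- **Lower (expansion) bound**: `(2nδ/3)‖p − p'‖ ≤ ‖θ_n(p) − θ_n(p')‖` — distinct momenta give
distinct end points, quantitatively. -/
theorem lfTraj_pos_expand (hG : LipschitzWith K G) (hδ : 0 ≤ δ)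
    (hn : 4 * (K : ℝ) * δ * (n : ℝ) ^ 2 ≤ 3) (p p' : E) :
    2 * ((n : ℝ) * δ) / 3 * ‖p - p'‖ ≤ ‖(lfTraj G δ θ₀ p n).1 - (lfTraj G δ θ₀ p' n).1‖ := by
  have h := lfTraj_pos_approx (θ₀ := θ₀) hG hδ hn p p'
  have hτ : 0 ≤ (n : ℝ) * δ := mul_nonneg n.cast_nonneg hδ
  have htri : ‖((n : ℝ) * δ) • (p - p')‖ ≤
      ‖(lfTraj G δ θ₀ p n).1 - (lfTraj G δ θ₀ p' n).1‖ +
        ‖(lfTraj G δ θ₀ p n).1 - (lfTraj G δ θ₀ p' n).1 - ((n : ℝ) * δ) • (p - p')‖ := by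
    calc ‖((n : ℝ) * δ) • (p - p')‖
        = ‖((lfTraj G δ θ₀ p n).1 - (lfTraj G δ θ₀ p' n).1) -
            ((lfTraj G δ θ₀ p n).1 - (lfTraj G δ θ₀ p' n).1 - ((n : ℝ) * δ) • (p - p'))‖ := by
          rw [sub_sub_cancel]
      _ ≤ _ := norm_sub_le _ _
  rw [norm_smul, Real.norm_of_nonneg hτ] at htri
  linarith

end TwoTrajectories

end Summit.Ventures.LatticeQCDFlow.Exactness
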